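import Mathlib.NumberTheory.Padics.MahlerBasis
import Literature.NumberTheory.EllipticCurves.PAdicLFunctionFunctionalEquationProofs
import Literature.NumberTheory.EllipticCurves.PAdicLFunctionFrickeSymmetryProofs
import Literature.NumberTheory.EllipticCurves.PAdicLFunctionInterpolationHoldsProofs
import Literature.NumberTheory.EllipticCurves.PAdicLFunctionInvolutionProofs
import Literature.NumberTheory.EllipticCurves.PAdicLFunctionNeZeroHoldsProofs
import Literature.NumberTheory.EllipticCurves.NewformsFrickeSignProofs
import Literature.NumberTheory.EllipticCurves.NewformsMainLemmaTraceProofs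
import Literature.NumberTheory.EllipticCurves.RootNumberModularityProofs
import Literature.NumberTheory.EllipticCurves.CuspFormLFunctionAnalyticRankProofs
import Literature.NumberTheory.EllipticCurves.KatoRankBoundLevelZeroProofs

/-!
# `ord_{T=0} L_p(E,T) ≡ ord_{s=1} L(E,s) (mod 2)` and `r_an ≤ 2 ⟹ r_an ≤ ord_{T=0} L_p(E,T)`

Parity of the order of vanishing of the Mazur–Tate–Teitelbaum `p`-adic `L`-function at `T = 0`
(good ordinary `p`) against the analytic rank, assembled from theorems of this directory; the only
hypotheses are the data (`f` the newform of `E` at level `N_E`, `p ∤ N_E` good ordinary).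

* `eq_neg_one_pow_order_of_subst_inv_eq` — pure power-series algebra: if `L ≠ 0` and
  `L(ι(T)) = σ (1+T)^c L(T)` with `ι = (1+T)⁻¹ - 1`, then `σ = (-1)^{ord L}` (lowest terms);
* `neg_one_pow_analyticRank_eq_of_hasFunctionalEquationSign` — `(-1)^{r_an} = w` from
  `Λ(2-s) = w Λ(s)` (`even_analyticRank_iff_of_hasFunctionalEquationSign` with a general sign);
* `even_order_padicLFunction_iff_even_analyticRank` — the parity transfer
  (Mazur–Tate–Teitelbaum 1986, §I.17–I.18: the sign of the `p`-adic functional equation at a good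
  prime is the root number): Atkin–Lehner (`w_N f = ε f`, `atkinLehnerMainLemma0_holds`), Hecke's
  functional equation with sign `-ε` on the complex side, the functional equation of `L_p(E,T)` with
  the same sign (`subst_padicLFunction_eq_of_symmetry`, fed by `msdMeasure_eq_mul_of_isFrickeEigen`,
  boundedness / convergence of the Mazur–Swinnerton-Dyer measure and `⟨N⟩ = γ^c`), and
  `L_p(E,T) ≠ 0` (Rohrlich 1984; `padicLFunction_unitRoot_ne_zero`);
* `two_le_order_padicLFunction_of_even_analyticRank`,
  `analyticRank_le_order_padicLFunction_of_le_two` — consequently `ord_T L_p ≥ 2` when `r_an` is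
  even and positive, and `r_an ≤ ord_{T=0} L_p(E,T)` whenever `r_an ≤ 2` (the case `r_an ≤ 1` is
  the interpolation property, `order_padicLFunction_eq_zero_iff_analyticRank_eq_zero`).

References: B. Mazur, J. Tate, J. Teitelbaum, *On `p`-adic analogues of the conjectures of Birch
and Swinnerton-Dyer*, Invent. Math. 84 (1986), §I.17–§I.18; D. Rohrlich, *On `L`-functions of
elliptic curves and cyclotomic towers*, Invent. Math. 75 (1984), Theorem p. 409; A. O. L. Atkin,
J. Lehner, *Hecke operators on `Γ₀(m)`*, Math. Ann. 185 (1970), Thm. 3; J. Silverman, *AEC*,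
App. C §16.
-/

noncomputable section

open scoped MatrixGroups

open PowerSeries Filter Topology CongruenceSubgroup
open Literature Literature.NumberTheory.EllipticCurves Literature.NumberTheory.EllipticCurves.ModularForms

namespace Literature.NumberTheory.EllipticCurves

/-! ### Pure algebra: the sign of an MTT-type functional equation is `(-1)^{ord}` -/

section Algebra

variable {p : ℕ} [Fact p.Prime]

/-- Lowest-term comparison in `L(ι(T)) = σ (1+T)^c L(T)` with `ι = (1+T)⁻¹ - 1`:
`σ = (-1)^{ord L}` for `L ≠ 0`. [folklore] -/
theorem eq_neg_one_pow_order_of_subst_inv_eq {L ι : ℚ_[p]⟦X⟧} {σ : ℚ_[p]} {c : ℤ_[p]}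
    (hι : (1 + X : ℚ_[p]⟦X⟧) * (ι + 1) = 1) (hL : L ≠ 0)
    (h : PowerSeries.subst ι L = C σ * PowerSeries.binomialSeries ℚ_[p] c * L) :
    σ = (-1 : ℚ_[p]) ^ L.order.toNat := by
  have hι0 : constantCoeff ι = 0 := constantCoeff_eq_zero_of_one_add_X_mul hι
  -- the linear coefficient of `ι` is `-1`
  have hι1 : coeff 1 ι = -1 := by
    have h1 := congr_arg (coeff 1) hι
    rw [add_mul, one_mul, map_add, map_add, coeff_succ_X_mul, map_add] at h1
    simp only [coeff_one, coeff_zero_eq_constantCoeff_apply, hι0, one_ne_zero, if_false, if_true,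
      zero_add, add_zero] at h1
    linear_combination h1
  -- `ι = X · q` with `q(0) = -1`
  set q : ℚ_[p]⟦X⟧ := PowerSeries.mk fun n ↦ coeff (n + 1) ι with hq
  have hιq : ι = X * q := by
    have e := eq_X_mul_shift_add_const ι
    rwa [hι0, map_zero, add_zero] at e
  have hcq : constantCoeff q = -1 := by
    rw [hq]
    show coeff (0 + 1) ι = -1
    simpa using hι1
  -- the diagonal coefficient `[T^d] ι^d = (-1)^d`
  have hdiag : ∀ d : ℕ, coeff d (ι ^ d) = (-1) ^ d := by
    intro d
    rw [hιq, mul_pow, coeff_X_pow_mul', if_pos le_rfl, Nat.sub_self,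
      coeff_zero_eq_constantCoeff_apply, map_pow, hcq]
  -- order bookkeeping: `ord L = m`, `[T^d] L = 0` for `d < m`, `[T^m] L ≠ 0`
  have hoT : L.order ≠ ⊤ := fun h' ↦ hL (order_eq_top.mp h')
  obtain ⟨m, hm⟩ := ENat.ne_top_iff_exists.mp hoT
  have hcm : coeff m L ≠ 0 := by
    have e := coeff_order hL
    rwa [← hm, ENat.toNat_coe] at e
  have hlt : ∀ d < m, coeff d L = 0 := fun d hd ↦
    coeff_of_lt_order d (by rw [← hm]; exact ENat.coe_lt_coe.mpr hd)
  rw [← hm, ENat.toNat_coe]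
  -- compare the coefficients of `T^m` on both sides of the functional equation
  have key := congr_arg (coeff m) h
  rw [coeff_subst_eq_sum_range hι0 L m, coeff_C_mul_binomialSeries_mul, Finset.sum_range_succ,
    Finset.sum_range_succ, Finset.sum_eq_zero, Finset.sum_eq_zero, zero_add, zero_add, hdiag,
    Nat.sub_self, Ring.choose_zero_right, map_one, one_mul] at key
  · exact (mul_right_cancel₀ hcm key).symm
  · intro k hk
    rw [hlt k (Finset.mem_range.mp hk), mul_zero]
  · intro k hk
    rw [hlt k (Finset.mem_range.mp hk), mul_zero]

/-- The same, read as a parity statement: `ord L` is even iff `σ = 1`. [folklore] -/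
theorem even_order_iff_of_subst_inv_eq {L ι : ℚ_[p]⟦X⟧} {σ : ℚ_[p]} {c : ℤ_[p]}
    (hι : (1 + X : ℚ_[p]⟦X⟧) * (ι + 1) = 1) (hL : L ≠ 0)
    (h : PowerSeries.subst ι L = C σ * PowerSeries.binomialSeries ℚ_[p] c * L) :
    Even L.order.toNat ↔ σ = 1 := by
  rw [eq_neg_one_pow_order_of_subst_inv_eq hι hL h, neg_one_pow_eq_one_iff_even (by norm_num)]

/-- The inversion `ι = (1+T)⁻¹ - 1 ∈ ℚ_p⟦T⟧` exists: `(1 + T)(ι + 1) = 1`. [folklore] -/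
theorem exists_inv_sub_one : ∃ ι : ℚ_[p]⟦X⟧, (1 + X : ℚ_[p]⟦X⟧) * (ι + 1) = 1 :=
  ⟨(1 + X : ℚ_[p]⟦X⟧)⁻¹ - 1, by
    rw [sub_add_cancel]
    exact PowerSeries.mul_inv_cancel _ (by simp)⟩

end Algebra

/-! ### Complex side: `(-1)^{r_an} = w` -/

/-- **`(-1)^{ord_{s=1} L(E,s)} = w`** whenever the completed `L`-function of the elliptic `W / ℚ`
(entire `L`-function) satisfies `Λ(2 - s) = w Λ(s)` at level `N_W` — the tree's
`even_analyticRank_iff_of_hasFunctionalEquationSign` with a general sign `w`.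
[cite: SilvermanAEC2009, App. C §16, Thm. C.16.3 (p. 451)] -/
theorem neg_one_pow_analyticRank_eq_of_hasFunctionalEquationSign (W : WeierstrassCurve ℚ)
    [W.IsElliptic] (hE : W.HasEntireLFunction) {w : ℤ} (hFE : W.HasFunctionalEquationSign w) :
    (-1 : ℂ) ^ W.analyticRank = w := by
  obtain ⟨Λ, hΛ, hfe⟩ := hFE
  set G : ℂ → ℂ := fun t ↦ Λ (1 + t) with hGdef
  have hGan : AnalyticAt ℂ G 0 := by
    have hΛ1 : AnalyticAt ℂ Λ (1 + 0) := hΛ.1.analyticAt _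
    exact hΛ1.comp_of_eq (analyticAt_const.add analyticAt_id) rfl
  have hGord : analyticOrderAt G 0 = W.analyticRank := by
    have hg : AnalyticAt ℂ (fun t : ℂ ↦ 1 + t) 0 := analyticAt_const.add analyticAt_id
    have hg' : deriv (fun t : ℂ ↦ 1 + t) 0 ≠ 0 := by
      rw [deriv_const_add, deriv_id'']
      exact one_ne_zero
    have := analyticOrderAt_comp_of_deriv_ne_zero (f := Λ) hg hg'
    simp only [Function.comp_def, add_zero] at this
    rw [hGdef, this]
    exact W.analyticOrderAt_completedLContinuation_one hE hΛ
  have hGfe : ∀ t : ℂ, G (-t) = (w : ℂ) * G t := by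
    intro t
    simp only [hGdef]
    rw [← hfe (1 + t)]
    congr 1
    ring
  exact neg_one_pow_eq_of_comp_neg_eq_mul hGan hGord hGfe

/-! ### The parity transfer -/

section Parity

variable (W : WeierstrassCurve ℚ) [W.IsElliptic] [W.IsGloballyMinimal] [NeZero (W.conductorNorm ℤ)]
  {f : CuspForm (Gamma0 (W.conductorNorm ℤ)) 2} (p : ℕ) [Fact p.Prime]

/-- **`ord_{T=0} L_p(E,T) ≡ ord_{s=1} L(E,s) (mod 2)`** at a good ordinary prime `p` of the
elliptic curve `E = W / ℚ` (globally minimal model, `f` its newform at level `N_E`): both parities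
are that of the common sign `w = -ε_f` of the two functional equations — Hecke's for
`Λ(E, s)` (`(-1)^{r_an} = w`) and Mazur–Tate–Teitelbaum's for `L_p(E, T)` (`(-1)^{ord_T L_p} = w`,
using `L_p(E,T) ≠ 0`, Rohrlich). [cite: MazurTateTeitelbaum1986Invent, §I.17–I.18]
[cite: RohrlichInventiones1984, Theorem (p. 409)] [cite: AtkinLehner1970, Thm. 3] -/
theorem even_order_padicLFunction_iff_even_analyticRank (hf : IsNewformOf W f)
    (hpN : ¬ p ∣ W.conductorNorm ℤ) (hord : IsOrdinaryAt W p) :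
    Even (padicLFunction f (unitRoot W p : ℚ_[p])).order.toNat ↔ Even W.analyticRank := by
  -- Atkin–Lehner: `w_N f = ε f` with `ε = ±1`; the common sign is `w = -ε`
  obtain ⟨ε, hε1, hFr⟩ := IsNewform0.exists_frickeInvolution_eq_smul_of_mainLemma0
    (W.conductorNorm ℤ) 2 (atkinLehnerMainLemma0_holds 2 (W.conductorNorm ℤ)) hf.1
  obtain ⟨w, hw1, hwε⟩ : ∃ w : ℤ, (w = 1 ∨ w = -1) ∧ (w : ℂ) = -ε := by
    rcases hε1 with rfl | rfl
    · exact ⟨-1, Or.inr rfl, by simp⟩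
    · exact ⟨1, Or.inl rfl, by simp⟩
  -- complex side
  have hE : W.HasEntireLFunction := hf.hasEntireLFunction
  obtain ⟨Λ, hΛ, hfe⟩ := exists_functional_equation_of_frickeInvolution_eq_smul
    (exists_completedCuspFormL_functional_equation_holds (W.conductorNorm ℤ) 2) hFr
  have hC : (-1 : ℂ) ^ W.analyticRank = w :=
    neg_one_pow_analyticRank_eq_of_hasFunctionalEquationSign W hE
      (W.hasFunctionalEquationSign_of_isNewformOf hE hf hΛ hfe hwε)
  -- p-adic side
  have hw2 : w ^ 2 = 1 := by rcases hw1 with rfl | rfl <;> norm_num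
  have hFr' : frickeInvolution (W.conductorNorm ℤ) 2 f = (-(w : ℂ)) • f := by
    rw [hFr, hwε, neg_neg]
  have hFrick : IsFrickeEigen (W.conductorNorm ℤ) f (-(w : ℂ)) :=
    isFrickeEigen_of_frickeInvolution_eq_smul _ hFr'
  have he : ∀ n : ℕ, 1 ≤ n + cyclotomicExponent p := fun n ↦
    le_add_left (by unfold cyclotomicExponent; split_ifs <;> omega)
  have hsym : ∀ (n : ℕ) (u u' : ZMod (p ^ (n + cyclotomicExponent p))),
      (W.conductorNorm ℤ : ZMod (p ^ (n + cyclotomicExponent p))) * u * u' = -1 →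
        msdMeasure f (unitRoot W p : ℚ_[p]) (n + cyclotomicExponent p) u =
          (w : ℚ_[p]) * msdMeasure f (unitRoot W p : ℚ_[p]) (n + cyclotomicExponent p) u' :=
    fun n u u' h ↦ msdMeasure_eq_mul_of_isFrickeEigen hw2 hFrick _ (he n) h
  obtain ⟨ηN, c, hc⟩ := exists_teichmuller_exponent_natCast (p := p) (hpN := hpN)
  obtain ⟨ι, hι⟩ := exists_inv_sub_one (p := p)
  have hFEp := subst_padicLFunction_eq_of_symmetry hsym
    (exists_norm_msdMeasure_le_of_isNewformOf hord hf)
    (tendsto_padicLRiemannSum_of_isNewformOf hord hf) hc hι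
  have hP := even_order_iff_of_subst_inv_eq hι (padicLFunction_unitRoot_ne_zero hord hf) hFEp
  -- both parities are `w = 1`
  rw [hP, Int.cast_eq_one]
  constructor
  · intro h1
    rw [h1, Int.cast_one] at hC
    exact (neg_one_pow_eq_one_iff_even (by norm_num)).mp hC
  · intro hev
    rw [hev.neg_one_pow] at hC
    exact_mod_cast hC.symm

/-- **`r_an` even and positive ⟹ `ord_{T=0} L_p(E,T) ≥ 2`** at a good ordinary prime: the order is
positive (`ord_T L_p = 0 ↔ r_an = 0`, interpolation) and even (parity transfer).
[cite: MazurTateTeitelbaum1986Invent, §I.14 (14.3) and §I.17] -/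
theorem two_le_order_padicLFunction_of_even_analyticRank (hf : IsNewformOf W f)
    (hpN : ¬ p ∣ W.conductorNorm ℤ) (hord : IsOrdinaryAt W p) (h0 : W.analyticRank ≠ 0)
    (hev : Even W.analyticRank) :
    2 ≤ (padicLFunction f (unitRoot W p : ℚ_[p])).order := by
  have hL0 := padicLFunction_unitRoot_ne_zero hord hf
  have hpar := (even_order_padicLFunction_iff_even_analyticRank W p hf hpN hord).mpr hev
  have hoT : (padicLFunction f (unitRoot W p : ℚ_[p])).order ≠ ⊤ :=
    fun h' ↦ hL0 (order_eq_top.mp h')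
  obtain ⟨m, hm⟩ := ENat.ne_top_iff_exists.mp hoT
  rw [← hm, ENat.toNat_coe] at hpar
  have hm0 : m ≠ 0 := by
    intro hm0
    have h00 : (padicLFunction f (unitRoot W p : ℚ_[p])).order = 0 := by
      rw [← hm, hm0, Nat.cast_zero]
    exact h0 ((order_padicLFunction_eq_zero_iff_analyticRank_eq_zero W p hord hf).mp h00)
  obtain ⟨k, rfl⟩ := hpar
  rw [← hm]
  exact_mod_cast (show 2 ≤ k + k by omega)

/-- **`r_an ≤ 2 ⟹ r_an ≤ ord_{T=0} L_p(E,T)`** at a good ordinary prime `p ∤ N_E` (`f` the newform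
of `E` at level `N_E`): `r_an = 0` is trivial, `r_an = 1` is `ord_T L_p ≥ 1 ↔ L(E,1) = 0`
(interpolation), `r_an = 2` is the parity transfer.
[cite: MazurTateTeitelbaum1986Invent, §I.14 (14.3) and §I.17] -/
theorem analyticRank_le_order_padicLFunction_of_le_two (hf : IsNewformOf W f)
    (hpN : ¬ p ∣ W.conductorNorm ℤ) (hord : IsOrdinaryAt W p) (h2 : W.analyticRank ≤ 2) :
    (W.analyticRank : ℕ∞) ≤ (padicLFunction f (unitRoot W p : ℚ_[p])).order := by
  rcases Nat.lt_or_ge W.analyticRank 1 with h | h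
  · have : W.analyticRank = 0 := by omega
    rw [this, Nat.cast_zero]
    exact zero_le
  rcases Nat.lt_or_ge W.analyticRank 2 with h' | h'
  · have ha : W.analyticRank = 1 := by omega
    rw [ha, Nat.cast_one, Order.one_le_iff_ne_zero]
    intro h00
    exact absurd ((order_padicLFunction_eq_zero_iff_analyticRank_eq_zero W p hord hf).mp h00)
      (by omega)
  · have ha : W.analyticRank = 2 := le_antisymm h2 h'
    rw [ha, Nat.cast_ofNat]
    exact two_le_order_padicLFunction_of_even_analyticRank W p hf hpN hord (by omega)
      (by rw [ha]; exact even_two)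

end Parity

end Literature.NumberTheory.EllipticCurves

end
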